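import Summits.AtomisticToContinuum.Crystallization.Theorems.FluxTubeKeplerFloorGivesLayered
import Summits.AtomisticToContinuum.Crystallization.Theorems.FluxTubeKeplerFluxCellKeplerSingleScale
import Summits.AtomisticToContinuum.Crystallization.Theorems.ChessboardParticlePlanesPeriodicWindowsIffCrystallization

/-!
# The hole-blind ladder `HoleRung D r` over `FluxTubeKepler.FloorGivesLayered` (crux `FluxCellKepler`)

Route `FluxTubeKepler`, crux `FluxCellKepler` (stmt-AtomisticToContinuum-15221), floor
`FluxTubeKeplerFloorGivesLayered.FloorGivesLayered_proof` (stmt-AtomisticToContinuum-15223): FLOOR(P₀)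
(`N·e(P₀) ≤ E(x)` on Lennard-Jones ground states) + BUDGET(P₀) (at every scale `(R, η)` some `c > 0`
with `c · #{(R, η)-non-layered sites} ≤ E(x) − N·e(P₀)`) ⇒ periodic windows along every ground-state
sequence (with the proved `PeriodicGivenLayered_holds`).

This file is the port to `Theorems/` of the graded family typed by the forward seat
`fwd2-rung-AtomisticToContinuum-01-g27` (`Cruxes/FluxCellKepler/Lines/G27HoleBlindRung_proved.lean`,
namespace `…Cruxes.FluxCellKepler.HoleLadder`; statements verbatim, namespace renamed):

* THE DIAL `(D, r)`. The budget is HOLE-BLIND: an `(R, η)`-bad site `i` is NOT priced when some EMPTY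
  point `y ∉ x` within distance `r` of `x i` is a hole of depth `≥ D` for the test-particle energy
  `f_x(y) = Σ_j V(|y − x_j|)` (`testEnergy`, `NearDeepHole`, `Budget`). `HoleRung D r` := FLOOR + the
  `(D, r)`-blind budget ⇒ periodic windows (`HasPeriodicWindows`, verbatim the conclusion of the route
  decl `FluxTubeKepler.PeriodicWindows` per sequence). The rung: `HoleBlindRung := ∀ D > −e⋆, HoleRung D 2`.
* MONOTONE DIAL: `holeRung_anti_radius` (larger blind radius = stronger rung), `holeRung_mono_depth`.
* F3 (the family specialises to the floor): with `r ≤ 0` nothing is un-priced and `HoleRung D r` is the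
  floor theorem followed by `PeriodicGivenLayered_holds` (`holeRung_of_radius_nonpos`, `holeRung_zero`).
* F4 (ON PATH): `Crystallization → HoleRung D r` for every `D, r` through the landed hull-criterion
  converse `periodicWindows_of_crystallization` (`holeRung_of_crystallization`,
  `HoleBlindRung_of_Crystallization`).

That the rung is in fact a THEOREM (`holeBlindRung_holds`: insertion stability + the chemical-potential
density `E(n+1) − E(n) ≥ e⋆ − θ` frequently + the floor's method along a frequent set of particle numbers)
is the companion file `FluxTubeKeplerHoleBlindRung.lean`. Not here: any pricing of the
un-priced class at every `N` (in-tree: `PhononSlackCertificatesNearFarGlueRHoles.holes_gap_near_of_floor`).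
-/

noncomputable section

namespace Summit.AtomisticToContinuum.Crystallization.Theorems.FluxCellKeplerHoleLadder

open Filter Topology
open Literature.MathematicalPhysics.StatisticalMechanics
open Summit.AtomisticToContinuum.Crystallization.Theorems.FluxCellKeplerSingleScale (LayeredGood)
open Summit.AtomisticToContinuum.Crystallization.Theorems.ChargedEnergyGapNegative (eStar)

/-! ## The graded family -/

/-- FLOOR(P₀): `N·e(P₀) ≤ E(x)` for every Lennard-Jones ground state `x` (verbatim the first hypothesis
of `FluxTubeKepler.FloorGivesLayered`). -/
def Floor (P₀ : PeriodicConfiguration 3) : Prop :=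
  ∀ (N : ℕ) (x : Fin N → EuclideanSpace ℝ (Fin 3)), IsGroundState lennardJones x →
    (N : ℝ) * P₀.energyPerParticle lennardJones ≤ interactionEnergy lennardJones x

/-- The TEST-PARTICLE energy `f_x(y) = Σ_j V_LJ(|y − x_j|)` of an extra particle at `y`. -/
def testEnergy {N : ℕ} (x : Fin N → EuclideanSpace ℝ (Fin 3)) (y : EuclideanSpace ℝ (Fin 3)) : ℝ :=
  ∑ j, lennardJones (dist y (x j))

/-- Site `i` of `x` lies within distance `r` of a HOLE OF DEPTH `≥ D`: an empty point `y ∉ x` with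
`dist y (x i) ≤ r` and `f_x(y) ≤ −D`. -/
def NearDeepHole (D r : ℝ) {N : ℕ} (x : Fin N → EuclideanSpace ℝ (Fin 3)) (i : Fin N) : Prop :=
  ∃ y : EuclideanSpace ℝ (Fin 3), y ∉ Set.range x ∧ dist y (x i) ≤ r ∧ testEnergy x y ≤ -D

/-- HOLE-BLIND BUDGET(P₀) with dial `(D, r)`: at scale `(R, η)` only the `(R, η)`-bad sites that are NOT
within `r` of a hole of depth `≥ D` are priced. -/
def Budget (D r : ℝ) (P₀ : PeriodicConfiguration 3) : Prop :=
  ∀ R η : ℝ, 0 < R → 0 < η → ∃ c : ℝ, 0 < c ∧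
    ∀ (N : ℕ) (x : Fin N → EuclideanSpace ℝ (Fin 3)), IsGroundState lennardJones x →
      c * (Nat.card {i : Fin N // ¬ LayeredGood R η x i ∧ ¬ NearDeepHole D r x i} : ℝ) ≤
        interactionEnergy lennardJones x - (N : ℝ) * P₀.energyPerParticle lennardJones

/-- Periodic windows along `x` (verbatim the conclusion of `ChessboardParticlePlanes.PeriodicWindows`). -/
def HasPeriodicWindows (x : (N : ℕ) → (Fin N → EuclideanSpace ℝ (Fin 3))) : Prop :=
  ∃ P : PeriodicConfiguration 3, ∀ R ε : ℝ, 0 < ε → ∃ᶠ N in atTop, ∃ t : EuclideanSpace ℝ (Fin 3),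
    (∀ s ∈ P.points, ‖s‖ ≤ R → ∃ i : Fin N, dist (x N i + t) s ≤ ε) ∧
    (∀ i : Fin N, ‖x N i + t‖ ≤ R → ∃ s ∈ P.points, dist (x N i + t) s ≤ ε)

/-- The graded family: FLOOR + the `(D, r)`-hole-blind budget force periodic windows along ground states. -/
def HoleRung (D r : ℝ) : Prop :=
  ∀ P₀ : PeriodicConfiguration 3, Floor P₀ → Budget D r P₀ →
    ∀ x : (N : ℕ) → (Fin N → EuclideanSpace ℝ (Fin 3)), (∀ N, IsGroundState lennardJones (x N)) →
      HasPeriodicWindows x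

/-- **The banked candidate rung**: a certificate blind within distance `2` of every hole deeper than the
ground-state energy per particle `|e⋆|` already forces periodic windows along the ground states. -/
def HoleBlindRung : Prop := ∀ D : ℝ, -eStar < D → HoleRung D 2

/-! ## Dial monotonicity -/

/-- A hole within `r` is within any `r' ≥ r`. -/
theorem nearDeepHole_mono_radius {D r r' : ℝ} (h : r ≤ r') {N : ℕ} (x : Fin N → EuclideanSpace ℝ (Fin 3))
    (i : Fin N) :
    NearDeepHole D r x i → NearDeepHole D r' x i := by
  rintro ⟨y, hy, hyr, hyD⟩
  exact ⟨y, hy, hyr.trans h, hyD⟩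

/-- A hole of depth `≥ D'` has depth `≥ D` for `D ≤ D'`. -/
theorem nearDeepHole_anti_depth {D D' r : ℝ} (h : D ≤ D') {N : ℕ} (x : Fin N → EuclideanSpace ℝ (Fin 3))
    (i : Fin N) :
    NearDeepHole D' r x i → NearDeepHole D r x i := by
  rintro ⟨y, hy, hyr, hyD⟩
  exact ⟨y, hy, hyr, by linarith⟩

/-- A budget pricing the larger set prices the smaller one. -/
theorem budget_of_subset {D D' r r' : ℝ} (P₀ : PeriodicConfiguration 3)
    (hsub : ∀ {N : ℕ} (x : Fin N → EuclideanSpace ℝ (Fin 3)) (i : Fin N),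
      NearDeepHole D r x i → NearDeepHole D' r' x i) :
    Budget D r P₀ → Budget D' r' P₀ := by
  classical
  intro hB R η hR hη
  obtain ⟨c, hc, hcB⟩ := hB R η hR hη
  refine ⟨c, hc, fun N x hx => le_trans ?_ (hcB N x hx)⟩
  have hle : Nat.card {i : Fin N // ¬ LayeredGood R η x i ∧ ¬ NearDeepHole D' r' x i} ≤
      Nat.card {i : Fin N // ¬ LayeredGood R η x i ∧ ¬ NearDeepHole D r x i} := by
    rw [Nat.card_eq_fintype_card, Nat.card_eq_fintype_card]
    exact Fintype.card_subtype_mono _ _ fun i hi => ⟨hi.1, fun h => hi.2 (hsub x i h)⟩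
  exact mul_le_mul_of_nonneg_left (by exact_mod_cast hle) hc.le

/-- `HoleRung` is ANTITONE in the radius: a larger blind radius un-prices more sites, the rung is stronger. -/
theorem holeRung_anti_radius {D r r' : ℝ} (h : r ≤ r') : HoleRung D r' → HoleRung D r :=
  fun H P₀ hF hB x hx => H P₀ hF (budget_of_subset P₀ (fun y i => nearDeepHole_mono_radius h y i) hB) x hx

/-- `HoleRung` is MONOTONE in the depth threshold: a deeper threshold un-prices fewer sites. -/
theorem holeRung_mono_depth {D D' r : ℝ} (h : D ≤ D') : HoleRung D r → HoleRung D' r :=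
  fun H P₀ hF hB x hx => H P₀ hF (budget_of_subset P₀ (fun y i => nearDeepHole_anti_depth h y i) hB) x hx

/-! ## F3 — the family at radius `r ≤ 0` is the proved floor -/

/-- With blind radius `r ≤ 0` no site is near a hole (the hole would sit ON the particle). -/
theorem not_nearDeepHole_of_nonpos {D r : ℝ} (hr : r ≤ 0) {N : ℕ} (x : Fin N → EuclideanSpace ℝ (Fin 3))
    (i : Fin N) :
    ¬ NearDeepHole D r x i := by
  rintro ⟨y, hy, hyr, -⟩
  have h0 : dist y (x i) = 0 := le_antisymm (hyr.trans hr) dist_nonneg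
  exact hy ⟨i, (dist_eq_zero.1 h0).symm⟩

/-- If no site of `x` is near a deep hole, the hole-blind count is the full defect count. -/
theorem card_eq_of_forall_not {D r R η : ℝ} {N : ℕ} (x : Fin N → EuclideanSpace ℝ (Fin 3))
    (hno : ∀ i : Fin N, ¬ NearDeepHole D r x i) :
    (Nat.card {i : Fin N // ¬ LayeredGood R η x i ∧ ¬ NearDeepHole D r x i} : ℝ) =
      Nat.card {i : Fin N // ¬ LayeredGood R η x i} := by
  have hiff : ∀ i : Fin N, (¬ LayeredGood R η x i ∧ ¬ NearDeepHole D r x i) ↔ ¬ LayeredGood R η x i :=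
    fun i => ⟨fun h => h.1, fun h => ⟨h, hno i⟩⟩
  exact_mod_cast Nat.card_congr (Equiv.subtypeEquivRight hiff)

/-- **F3.** `HoleRung D r` for `r ≤ 0` — every bad site priced — is the seed `FloorGivesLayered_proof`
followed by the proved `PeriodicGivenLayered_holds`. [folklore] -/
theorem holeRung_of_radius_nonpos {r : ℝ} (hr : r ≤ 0) (D : ℝ) : HoleRung D r := by
  intro P₀ hF hB x hx
  refine Theses.FluxTubeKepler.PeriodicGivenLayered_holds x hx
    (Theorems.FluxTubeKeplerFloorGivesLayered.FloorGivesLayered_proof P₀ hF ?_ x hx)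
  intro R η hR hη
  obtain ⟨c, hc, hcB⟩ := hB R η hR hη
  refine ⟨c, hc, fun N y hy => ?_⟩
  show c * (Nat.card {i : Fin N // ¬ LayeredGood R η y i} : ℝ) ≤ _
  rw [← card_eq_of_forall_not y (fun i => not_nearDeepHole_of_nonpos hr y i)]
  exact hcB N y hy

/-- **F3 witness**: `HoleRung D 0` (blind radius `0`) — the floor value of the dial. [folklore] -/
theorem holeRung_zero (D : ℝ) : HoleRung D 0 := holeRung_of_radius_nonpos le_rfl D

/-- Every member of the family gives the floor value back. -/
theorem holeRung_zero_of_holeRung {D r : ℝ} (hr : 0 ≤ r) (h : HoleRung D r) : HoleRung D 0 :=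
  holeRung_anti_radius hr h

/-! ## F4 — on path: `Crystallization → HoleRung D r` -/

/-- ON-PATH: the sub-problem implies every member of the family (landed hull-criterion converse). -/
theorem holeRung_of_crystallization (D r : ℝ) (h : _root_.Crystallization) : HoleRung D r :=
  fun _ _ _ x hx =>
    Theorems.ChessboardParticlePlanesPeriodicWindowsIffCrystallization.periodicWindows_of_crystallization
      h x hx

/-- **F4 — ON PATH: `Crystallization → HoleBlindRung`** (the sub-problem implies the rung; `aesop`-visible so
that the tribunal's cheap `S → C` portfolio finds it). [folklore] -/
@[aesop safe apply]
theorem HoleBlindRung_of_Crystallization (h : _root_.Crystallization) : HoleBlindRung :=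
  fun D _ => holeRung_of_crystallization D 2 h

end Summit.AtomisticToContinuum.Crystallization.Theorems.FluxCellKeplerHoleLadder

end
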